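import Summits.CriticalPhenomena.Ising3D.Control2DUnboundedSpectrumFree
import Mathlib.Analysis.SpecialFunctions.Pow.Real
import Mathlib.Tactic.Linarith
import Mathlib.Tactic.Positivity
import Mathlib.Tactic.Ring
import Mathlib.Tactic.FieldSimp
import HarnessLib

/-!
# OPE convergence on the open square is UNCONDITIONAL for every unitary solution of the typed sum rule at `Δ_σ > 0`
(cell `pub-ising3x`, seat controls-1 gen 43; PAPER §6.2 / Appendix E — CONTROL-ONLY; part 6, completing
`Control2DFourPoint` (gen 42) and `Control2DUnboundedSpin`)

HONEST FRAMING: lottery ticket; floor = tightest certified 3D Ising CFT bounds; no exact-solution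
claim without a proof. CONTROL-ONLY (`d = 2`, global `sl(2) × sl(2)` blocks, `Δ_σ = s` an INPUT, axiom set
`A2D′`); nothing here is about `d = 3`, no certificate, functional or number of the record is touched, and no
new hypothesis or named fact enters.

WHAT THIS FILE ADDS. `Control2DFourPoint.opeConvergent_of_lowerBound` (gen 42) derived absolute convergence of the
`s`-channel expansion `Σ p_i g_i(z,z̄)` on the open square from the typed sum rule under a uniform lower bound
`Δ_i ≥ τ₀ > 2Δ_σ` on the exchanged dimensions, and left the case of low scalars (`Δ ≤ 2Δ_σ`) open. The two-point sign
lemmas of `Control2DDiagonalSign` close it: for EVERY unitary solution and every `H`, the labels of dimension `≤ H` have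
summable coefficients (`summable_p_low_free` — each of their sum-rule terms is `≤ -c · p_i` at `x = 1/4` or at the
near-corner point `x₂`, and the terms are absolutely summable), while the labels above `H > 2Δ_σ` converge by the gen-42
sign argument (`opeConvergent_on`). Hence:

* **`CrossingData.opeConvergent_free`** — `IsUnitary`, `SatisfiesCrossing s`, `0 < s` ⇒ `OpeConvergent`. No gap, no
  location, no lower bound: the typed pointwise sum rule at `Δ_σ > 0` IMPLIES absolute convergence of the expansion at
  every point of the real open square.
* Consequences, all now for EVERY unitary typed solution at `s > 0`: `fourPoint_crossing_free` (`v^s G(z,z̄) =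
  u^s G(1-z,1-z̄)` on the square), **`satisfiesCrossing_iff_fourPoint_free`** (for unitary data: the typed sum rule ⇔
  convergent expansion ∧ crossing symmetry of `G` — both directions without any spectral hypothesis),
  `fourPoint_lower_free`; and the SPIN theorem of `Control2DUnboundedSpin` without its clause:
  **`exists_spin_gt_free`**, **`infinite_spin_above_free`**, `infinite_spinning_free` — every unitary solution of the
  typed sum rule at `Δ_σ > 0` has non-zero OPE coefficients at arbitrarily large spin.

NOT claimed: anything at `s = 0` (the empty datum solves the sum rule; and `OpeConvergent` is vacuous there anyway);
convergence anywhere off the REAL open square (no complex domain, no `ρ`-coordinates); uniformity of convergence; rates,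
densities, twists; Virasoro; anything three-dimensional; any new bound; no number of the record touched.

References: R. Rattazzi, V. S. Rychkov, E. Tonni, A. Vichi, JHEP 12 (2008) 031, §3 [cite: RattazziEtAl2008, §3];
D. Pappadopulo, S. Rychkov, J. Espin, R. Rattazzi, Phys. Rev. D 86 (2012) 105043, §4 (OPE convergence — an INPUT there,
here a CONSEQUENCE of the typed class with no spectral assumption); F. A. Dolan, H. Osborn, Nucl. Phys. B 678 (2004) 491, §3
[cite: DolanOsborn2004, §3]. Tree: `exists_crossF_quarter_neg`, `exists_crossF_low_neg` (`Control2DDiagonalSign`);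
`exists_globalBlock_diag_le_envelope` (`Control2DChiralEnvelope`); `opeConvergent_on`, `globalBlock_le_diag`,
`globalBlock_nonneg`, `fourPoint_crossing`, `satisfiesCrossing_of_fourPoint` (`Control2DFourPoint`); `fourPoint_lower`
(`Control2DFourPointBounds`); `exists_spin_gt`, `infinite_spin_above` (`Control2DUnboundedSpin`). Mathlib: `Summable.abs`,
`Summable.subtype`, `summable_subtype_and_compl`, `Summable.of_nonneg_of_le`.
-/

namespace Summit.CriticalPhenomena.Ising3D.Control2D

open Set
open Literature.MathematicalPhysics.QuantumFieldTheory.ConformalBootstrap3D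

namespace CrossingData

variable {D : CrossingData} {s : ℝ}

/-- **The low-dimension coefficients of EVERY unitary solution are summable**: for every `H`,
`Σ_{Δ_i ≤ H} p_i < ∞` — each sum-rule term of a label with `Δ_i ≤ H` is `≤ -c₁ p_i` at `(1/4,1/4)` (if `Δ_i ≥ 2s - δ`) or
`≤ -c₂ p_i` at `(x₂,x₂)` (if `Δ_i ≤ 2s - δ`), and both term families are absolutely summable. No convergence hypothesis.
[folklore] -/
theorem summable_p_low_free (hU : D.IsUnitary) (hC : D.SatisfiesCrossing s) (hs : 0 < s) (H : ℝ) :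
    Summable fun i => if D.Δ i ≤ H then D.p i else 0 := by
  obtain ⟨δ, c₁, hδ0, -, hc₁, h₁⟩ := exists_crossF_quarter_neg H hs
  obtain ⟨x₂, c₂, hx₂, hx₂1, hc₂, h₂⟩ := exists_crossF_low_neg hs hδ0
  have hq : (1 / 4 : ℝ) ∈ Ioo (0 : ℝ) 1 := ⟨by norm_num, by norm_num⟩
  have hx : x₂ ∈ Ioo (0 : ℝ) 1 := ⟨by linarith, hx₂1⟩
  have S1 := ((hC (1 / 4) (1 / 4) hq hq).summable.abs).mul_left c₁⁻¹
  have S2 := ((hC x₂ x₂ hx hx).summable.abs).mul_left c₂⁻¹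
  refine (S1.add S2).of_nonneg_of_le (fun i => ?_) fun i => ?_
  · by_cases h : D.Δ i ≤ H
    · simp only [h, if_true]; exact (hU i).2.2
    · simp [h]
  have hp0 : 0 ≤ D.p i := (hU i).2.2
  have hA : 0 ≤ c₁⁻¹ * |D.p i * crossF s (-1) (globalBlock (D.Δ i) (D.spin i)) (1 / 4) (1 / 4)| :=
    mul_nonneg (inv_nonneg.mpr hc₁.le) (abs_nonneg _)
  have hB : 0 ≤ c₂⁻¹ * |D.p i * crossF s (-1) (globalBlock (D.Δ i) (D.spin i)) x₂ x₂| :=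
    mul_nonneg (inv_nonneg.mpr hc₂.le) (abs_nonneg _)
  by_cases hH : D.Δ i ≤ H
  · simp only [hH, if_true]
    rcases le_or_gt (2 * s - δ) (D.Δ i) with hhi | hlo
    · have hF := h₁ (D.Δ i) (D.spin i) (hU i).2.1 hhi hH
      have habs : c₁ * D.p i ≤ |D.p i * crossF s (-1) (globalBlock (D.Δ i) (D.spin i)) (1 / 4) (1 / 4)| := by
        rw [abs_mul, abs_of_nonneg hp0]
        have : c₁ ≤ |crossF s (-1) (globalBlock (D.Δ i) (D.spin i)) (1 / 4) (1 / 4)| := by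
          rw [abs_of_neg (by linarith)]; linarith
        nlinarith
      have : D.p i ≤ c₁⁻¹ * |D.p i * crossF s (-1) (globalBlock (D.Δ i) (D.spin i)) (1 / 4) (1 / 4)| :=
        calc D.p i = c₁⁻¹ * (c₁ * D.p i) := by field_simp
          _ ≤ _ := mul_le_mul_of_nonneg_left habs (inv_nonneg.mpr hc₁.le)
      linarith
    · have hF := h₂ (D.Δ i) (D.spin i) (hU i).2.1 hlo.le
      have habs : c₂ * D.p i ≤ |D.p i * crossF s (-1) (globalBlock (D.Δ i) (D.spin i)) x₂ x₂| := by
        rw [abs_mul, abs_of_nonneg hp0]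
        have : c₂ ≤ |crossF s (-1) (globalBlock (D.Δ i) (D.spin i)) x₂ x₂| := by
          rw [abs_of_neg (by linarith)]; linarith
        nlinarith
      have : D.p i ≤ c₂⁻¹ * |D.p i * crossF s (-1) (globalBlock (D.Δ i) (D.spin i)) x₂ x₂| :=
        calc D.p i = c₂⁻¹ * (c₂ * D.p i) := by field_simp
          _ ≤ _ := mul_le_mul_of_nonneg_left habs (inv_nonneg.mpr hc₂.le)
      linarith
  · simp only [hH, if_false]; linarith

/-- **OPE convergence is unconditional at `Δ_σ > 0`.** Every unitary solution of the typed `⟨σσσσ⟩` sum rule at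
`Δ_σ = s > 0` has its `s`-channel expansion `Σ p_i g_{Δ_i,ℓ_i}(z,z̄)` absolutely convergent at EVERY point of the open
square: the labels with `Δ_i ≤ H := 2s + 1` have summable coefficients (`summable_p_low_free`) and bounded blocks
(`exists_globalBlock_diag_le_envelope`, `globalBlock_le_diag`), the labels above `H > 2s` converge by the sign argument
of `opeConvergent_on`. No gap, location or lower-bound hypothesis. [cite: RattazziEtAl2008, §3] -/
theorem opeConvergent_free (hU : D.IsUnitary) (hC : D.SatisfiesCrossing s) (hs : 0 < s) : D.OpeConvergent := by
  intro z zb hz hzb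
  set H : ℝ := 2 * s + 1 with hH
  have hH2 : 2 * s < H := by linarith
  obtain ⟨K, hK0, hK⟩ := exists_globalBlock_diag_le_envelope H (ε := 1) one_pos
  set m : ℝ := max z zb with hm
  have hm0 : 0 < m := lt_max_of_lt_left hz.1
  have hm1 : m < 1 := max_lt hz.2 hzb.2
  have hQ := summable_p_low_free hU hC hs H
  refine (summable_subtype_and_compl (f := fun i => D.p i * globalBlock (D.Δ i) (D.spin i) z zb)
    (s := ({i : D.ι | D.Δ i ≤ H} : Set D.ι))).mp ⟨?_, ?_⟩
  · -- low labels: `p_i g_i(z,z̄) ≤ q_i · 2(K/(1-m))²`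
    have hQC : Summable fun i : ({i : D.ι | D.Δ i ≤ H} : Set D.ι) =>
        (if D.Δ (i : D.ι) ≤ H then D.p i else 0) * (2 * (K / (1 - m) ^ (1 : ℝ)) ^ 2) :=
      (hQ.mul_right (2 * (K / (1 - m) ^ (1 : ℝ)) ^ 2)).subtype _
    refine hQC.of_nonneg_of_le (fun i => mul_nonneg (hU i).2.2 (globalBlock_nonneg (hU i).2.1 hz hzb)) fun i => ?_
    have hi : D.Δ (i : D.ι) ≤ H := i.2
    rw [if_pos hi]
    exact mul_le_mul_of_nonneg_left ((globalBlock_le_diag (hU i).2.1 hz hzb).trans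
      (hK _ _ (hU i).2.1 hi m hm0 hm1)) (hU i).2.2
  · -- high labels: the gen-42 sign argument on the sub-family
    exact opeConvergent_on hU hC hH2 _ (fun i hi => (lt_of_not_ge hi).le) hz hzb

/-! ### Consequences for every unitary typed solution at `Δ_σ > 0` -/

/-- **Crossing symmetry of the four-point function, unconditionally**: `v^s G(z,z̄) = u^s G(1-z,1-z̄)` on the open square
for every unitary solution of the typed sum rule at `s > 0`. [cite: RattazziEtAl2008, §3 eq. (3.3)] -/
theorem fourPoint_crossing_free (hU : D.IsUnitary) (hC : D.SatisfiesCrossing s) (hs : 0 < s) {z zb : ℝ}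
    (hz : z ∈ Ioo (0 : ℝ) 1) (hzb : zb ∈ Ioo (0 : ℝ) 1) :
    ((1 - z) * (1 - zb)) ^ s * D.fourPoint z zb = (z * zb) ^ s * D.fourPoint (1 - z) (1 - zb) :=
  fourPoint_crossing hC (opeConvergent_free hU hC hs) hz hzb

/-- **The typed sum rule IS «convergent expansion + crossing-symmetric `G`», for every unitary datum at `s > 0`** — both
directions without any spectral hypothesis (compare `satisfiesCrossing_iff_fourPoint`, which needed `Δ_i ≥ τ₀ > 2s`).
[cite: RattazziEtAl2008, §3] -/
theorem satisfiesCrossing_iff_fourPoint_free (hU : D.IsUnitary) (hs : 0 < s) :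
    D.SatisfiesCrossing s ↔
      D.OpeConvergent ∧ ∀ z zb : ℝ, z ∈ Ioo (0 : ℝ) 1 → zb ∈ Ioo (0 : ℝ) 1 →
        ((1 - z) * (1 - zb)) ^ s * D.fourPoint z zb = (z * zb) ^ s * D.fourPoint (1 - z) (1 - zb) :=
  ⟨fun hC => ⟨opeConvergent_free hU hC hs, fun _ _ hz hzb => fourPoint_crossing_free hU hC hs hz hzb⟩,
    fun h => satisfiesCrossing_of_fourPoint h.1 h.2⟩

/-- The crossing lower bound `u^s ≤ v^s G(z,z̄)` for every unitary typed solution at `s > 0` (no convergence hypothesis).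
[cite: RattazziEtAl2008, §3] -/
theorem fourPoint_lower_free (hU : D.IsUnitary) (hC : D.SatisfiesCrossing s) (hs : 0 < s) {z zb : ℝ}
    (hz : z ∈ Ioo (0 : ℝ) 1) (hzb : zb ∈ Ioo (0 : ℝ) 1) :
    (z * zb) ^ s ≤ ((1 - z) * (1 - zb)) ^ s * D.fourPoint z zb :=
  fourPoint_lower hU hC (opeConvergent_free hU hC hs) hz hzb

/-- **No bounded spin — hypothesis-free.** Every unitary solution of the typed sum rule at `Δ_σ = s > 0` has, above
every `L`, a label with non-zero squared OPE coefficient and spin `> L` (`exists_spin_gt` with its convergence clause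
discharged by `opeConvergent_free`). [folklore] -/
theorem exists_spin_gt_free (hU : D.IsUnitary) (hC : D.SatisfiesCrossing s) (hs : 0 < s) (L : ℕ) :
    ∃ i, D.p i ≠ 0 ∧ L < D.spin i :=
  exists_spin_gt hU hC hs (opeConvergent_free hU hC hs) L

/-- Infinitely many labels of spin above every bound, for every unitary typed solution at `s > 0`. [folklore] -/
theorem infinite_spin_above_free (hU : D.IsUnitary) (hC : D.SatisfiesCrossing s) (hs : 0 < s) (L : ℕ) :
    {i | D.p i ≠ 0 ∧ L < D.spin i}.Infinite :=
  infinite_spin_above hU hC hs (opeConvergent_free hU hC hs) L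

/-- Infinitely many SPINNING quasi-primaries with non-zero coefficient, for every unitary typed solution at `s > 0`:
no tower of scalars solves the typed sum rule. [folklore] -/
theorem infinite_spinning_free (hU : D.IsUnitary) (hC : D.SatisfiesCrossing s) (hs : 0 < s) :
    {i | D.p i ≠ 0 ∧ D.spin i ≠ 0}.Infinite :=
  infinite_spinning hU hC hs (opeConvergent_free hU hC hs)

end CrossingData

/-- **At `Δ_σ = 1/8`**: every unitary solution of the typed sum rule — no statement-class hypothesis, no use of the
record — has convergent expansion on the open square and non-zero OPE coefficients at arbitrarily large SPIN (and, by
`unbounded_spectrum_eighth`, at arbitrarily high dimension). CONTROL-ONLY. [folklore] -/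
theorem unbounded_spin_eighth (D : CrossingData) (hU : D.IsUnitary) (hC : D.SatisfiesCrossing (1 / 8)) (L : ℕ) :
    {i | D.p i ≠ 0 ∧ L < D.spin i}.Infinite :=
  CrossingData.infinite_spin_above_free hU hC (by norm_num) L

end Summit.CriticalPhenomena.Ising3D.Control2D
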